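import Literature.Computability.QuantumComplexity.SolovayKitaev.Basic
import Literature.MathematicalPhysics.QuantumLattice.GaugeGroupsProofs
import HarnessLib

/-!
# Solovay–Kitaev theorem: logarithms and exponentials through the diagonal torus

Proof infrastructure for the discharge of
`Literature.Computability.QuantumComplexity.solovay_kitaev` (Dawson–Nielsen, *The Solovay–Kitaev
algorithm*, QIC **6** (2006), Thm 1; §5.2 for `SU(d)`).  Dawson–Nielsen use two facts about the
exponential map of `SU(d)` without proof: every `U ∈ SU(d)` close to `1` is `exp(iH)` with `H`
Hermitian, *traceless*, `‖H‖ = O(d(I,U))`; and `exp(iF) ∈ SU(d)` with `d(I, exp(iF)) ≤ ‖F‖` for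
`F` Hermitian traceless.  Mathlib (at the pin) has neither the logarithm nor
`det (exp A) = exp (trace A)`, so both are obtained here *by hand through the diagonal torus*:

* `exists_traceless_log` — for `U ∈ SU(n)` with `2 · |n| · ‖U - 1‖ ≤ 1` there is a Hermitian
  traceless `H` with `‖H‖ ≤ 2‖U - 1‖` and `‖U - 1 - iH‖ ≤ 4‖U - 1‖²` (conjugate `U` into the
  diagonal torus, `Literature.MathematicalPhysics.QuantumLattice.exists_conj_eq_diagonal`, take
  arguments of the eigenvalues; `det U = 1` forces the arguments to sum to `0`);
* `exists_specialUnitary_near` — for `G` Hermitian traceless with `‖G‖ ≤ 1` there is `V ∈ SU(n)`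
  with `‖V - 1‖ ≤ ‖G‖` and `‖V - 1 - iG‖ ≤ ‖G‖²` (namely `V = Q diag(e^{iγ}) Q⋆` for the spectral
  decomposition `G = Q diag(γ) Q⋆`, Mathlib `Matrix.IsHermitian.spectral_theorem`).

All norms are the `L²`-operator norm (`open scoped Matrix.Norms.L2Operator`).  No definitions and
no new statements are introduced; everything is proved.
-/

noncomputable section

open scoped Matrix.Norms.L2Operator ComplexConjugate

namespace Literature.Computability.QuantumComplexity.SolovayKitaev

open Matrix Complex Literature.MathematicalPhysics.QuantumLattice

variable {n : Type*} [Fintype n] [DecidableEq n]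

/-! ### Norms of diagonal matrices and unitary conjugates -/

/-- The operator norm of a diagonal matrix is bounded by a bound on its entries. [folklore] -/
theorem norm_diagonal_le {w : n → ℂ} {C : ℝ} (hC : 0 ≤ C) (h : ∀ k, ‖w k‖ ≤ C) :
    ‖(diagonal w : Matrix n n ℂ)‖ ≤ C := by
  rw [Matrix.l2_opNorm_diagonal]
  exact (pi_norm_le_iff_of_nonneg hC).2 h

/-- Each entry of a diagonal matrix is bounded by the operator norm. [folklore] -/
theorem norm_apply_le_norm_diagonal (w : n → ℂ) (k : n) :
    ‖w k‖ ≤ ‖(diagonal w : Matrix n n ℂ)‖ := by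
  rw [Matrix.l2_opNorm_diagonal]
  exact norm_le_pi_norm w k

/-- Conjugation by a unitary matrix is isometric for the operator norm. [folklore] -/
theorem norm_unitary_conj {Q : Matrix n n ℂ} (hQ : Q ∈ Matrix.unitaryGroup n ℂ)
    (A : Matrix n n ℂ) : ‖Q * A * star Q‖ = ‖A‖ := by
  rw [CStarRing.norm_mul_mem_unitary (Q * A) (Unitary.star_mem hQ),
    CStarRing.norm_mem_unitary_mul A hQ]

/-- `Q (diagonal a) Q⋆ - Q (diagonal b) Q⋆ = Q (diagonal (a - b)) Q⋆`. [folklore] -/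
theorem conj_diagonal_sub (Q : Matrix n n ℂ) (a b : n → ℂ) :
    Q * diagonal a * star Q - Q * diagonal b * star Q = Q * diagonal (a - b) * star Q := by
  rw [show diagonal (a - b) = diagonal a - diagonal b from (diagonal_sub a b).symm,
    Matrix.mul_sub, Matrix.sub_mul]

/-- `Q Q⋆ = 1` written as a conjugated diagonal: `1 = Q (diagonal 1) Q⋆`. [folklore] -/
theorem one_eq_conj_diagonal_one {Q : Matrix n n ℂ} (hQ : Q ∈ Matrix.unitaryGroup n ℂ) :
    (1 : Matrix n n ℂ) = Q * diagonal (fun _ => (1 : ℂ)) * star Q := by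
  rw [diagonal_one, Matrix.mul_one, Unitary.mul_star_self_of_mem hQ]

/-- Scalars pass inside a conjugated diagonal: `c • (Q (diagonal a) Q⋆) = Q (diagonal (c • a)) Q⋆`.
[folklore] -/
theorem smul_conj_diagonal (Q : Matrix n n ℂ) (c : ℂ) (a : n → ℂ) :
    c • (Q * diagonal a * star Q) = Q * diagonal (c • a) * star Q := by
  rw [diagonal_smul, Matrix.mul_smul, Matrix.smul_mul]

/-! ### Scalar estimates on the unit circle -/

/-- `‖e^{iθ} - 1‖ ≤ |θ|`. [folklore] -/
theorem norm_exp_mul_I_sub_one_le (θ : ℝ) : ‖cexp (θ * I) - 1‖ ≤ |θ| := by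
  rw [mul_comm, Complex.norm_exp_I_mul_ofReal_sub_one, Real.norm_eq_abs, abs_mul, abs_two]
  have h := Real.abs_sin_le_abs (x := θ / 2)
  rw [abs_div, abs_two] at h
  linarith

/-- Jordan's inequality on the circle: `|θ| ≤ (π/2) ‖e^{iθ} - 1‖` for `|θ| ≤ π`. [folklore] -/
theorem abs_le_pi_div_two_mul_norm_exp_mul_I_sub_one {θ : ℝ} (hθ : |θ| ≤ Real.pi) :
    |θ| ≤ Real.pi / 2 * ‖cexp (θ * I) - 1‖ := by
  rw [mul_comm (θ : ℂ), Complex.norm_exp_I_mul_ofReal_sub_one, Real.norm_eq_abs, abs_mul,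
    abs_two]
  have hpi := Real.pi_pos
  have h2 : |θ / 2| ≤ Real.pi / 2 := by rw [abs_div, abs_two]; linarith
  -- Jordan's inequality `(2/π)|x| ≤ |sin x|` on `|x| ≤ π/2` (Mathlib `Real.mul_le_sin`)
  have h : 2 / Real.pi * |θ / 2| ≤ |Real.sin (θ / 2)| := by
    rcases le_total 0 (θ / 2) with h | h
    · rw [abs_of_nonneg h]
      exact (Real.mul_le_sin h (by rwa [abs_of_nonneg h] at h2)).trans (le_abs_self _)
    · rw [abs_of_nonpos h]
      have hx' : -(θ / 2) ≤ Real.pi / 2 := by rwa [abs_of_nonpos h] at h2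
      calc 2 / Real.pi * -(θ / 2) ≤ Real.sin (-(θ / 2)) := Real.mul_le_sin (by linarith) hx'
        _ ≤ |Real.sin (θ / 2)| := by rw [Real.sin_neg]; exact neg_le_abs _
  rw [abs_div, abs_two] at h
  -- `h : 2/π * (|θ|/2) ≤ |sin (θ/2)|`
  have : |θ| = Real.pi * (2 / Real.pi * (|θ| / 2)) := by field_simp
  rw [this]
  nlinarith [abs_nonneg (Real.sin (θ / 2))]

/-- `‖e^{iθ} - 1 - iθ‖ ≤ θ²` for `|θ| ≤ 1`. [folklore] -/
theorem norm_exp_mul_I_sub_one_sub_le {θ : ℝ} (hθ : |θ| ≤ 1) :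
    ‖cexp (θ * I) - 1 - θ * I‖ ≤ θ ^ 2 := by
  have hn : ‖(θ : ℂ) * I‖ = |θ| := by simp
  have h := Complex.norm_exp_sub_one_sub_id_le (x := θ * I) (by rw [hn]; exact hθ)
  rwa [hn, sq_abs] at h

/-- A complex number of norm one is `e^{i arg}`. [folklore] -/
theorem exp_arg_mul_I_of_norm_eq_one {z : ℂ} (hz : ‖z‖ = 1) : cexp (z.arg * I) = z := by
  have h := Complex.norm_mul_exp_arg_mul_I z
  rwa [hz, Complex.ofReal_one, one_mul] at h

/-- If `e^{iT} = 1` and `|T| < 2π` then `T = 0`. [folklore] -/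
theorem eq_zero_of_exp_mul_I_eq_one {T : ℝ} (h : cexp (T * I) = 1) (hT : |T| < 2 * Real.pi) :
    T = 0 := by
  obtain ⟨m, hm⟩ := Complex.exp_eq_one_iff.1 h
  have h2 : (T : ℂ) * I = ((m : ℂ) * (2 * Real.pi)) * I := by rw [hm]; ring
  have h3 : (T : ℂ) = (m : ℂ) * (2 * Real.pi) := mul_right_cancel₀ I_ne_zero h2
  have hTm : T = m * (2 * Real.pi) := by exact_mod_cast h3
  have h2pi : (0 : ℝ) < 2 * Real.pi := by positivity
  have habs : |(m : ℝ)| < 1 := by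
    rw [hTm, abs_mul, abs_of_pos h2pi] at hT
    exact (mul_lt_iff_lt_one_left h2pi).1 hT
  have hm0 : m = 0 := by
    have : |m| < 1 := by exact_mod_cast habs
    exact Int.abs_lt_one_iff.1 this
  rw [hTm, hm0]; simp

/-! ### The traceless logarithm on `SU(n)` near the identity -/

/-- **Traceless Hermitian logarithm near `1`.**  If `U ∈ SU(n)` satisfies
`2 · |n| · ‖U - 1‖ ≤ 1`, there is a Hermitian traceless matrix `H` with `‖H‖ ≤ 2‖U - 1‖` and
`‖U - 1 - iH‖ ≤ 4‖U - 1‖²` (indeed `U = exp(iH)`; only these two estimates are used by the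
Solovay–Kitaev recursion).  Dawson–Nielsen 2006 §5.2 ("we can find Hermitian `H` such that
`U = exp(iH)` and `d(I,U) = ‖H‖ + O(‖H‖³)`"), with the tracelessness needed for their Lemma 2 made
explicit: `U = u · diag(e^{iθ_k}) · u⁻¹` in `SU(n)`, `|θ_k| ≤ (π/2)|e^{iθ_k} - 1| ≤ 2‖U - 1‖`,
and `∑ θ_k ∈ 2πℤ` has absolute value `< 2π`. [cite: DawsonNielsen2006, §5.2] -/
theorem exists_traceless_log (U : Matrix.specialUnitaryGroup n ℂ)
    (hU : 2 * (Fintype.card n : ℝ) * ‖(U : Matrix n n ℂ) - 1‖ ≤ 1) :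
    ∃ H : Matrix n n ℂ, H.IsHermitian ∧ H.trace = 0 ∧ ‖H‖ ≤ 2 * ‖(U : Matrix n n ℂ) - 1‖ ∧
      ‖(U : Matrix n n ℂ) - 1 - I • H‖ ≤ 4 * ‖(U : Matrix n n ℂ) - 1‖ ^ 2 := by
  cases isEmpty_or_nonempty n with
  | inl hn =>
    refine ⟨0, isHermitian_zero, Matrix.trace_zero n ℂ, ?_, ?_⟩
    · rw [norm_zero]; positivity
    · rw [Subsingleton.elim ((U : Matrix n n ℂ) - 1 - I • (0 : Matrix n n ℂ)) 0, norm_zero]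
      positivity
  | inr hn =>
    set δ : ℝ := ‖(U : Matrix n n ℂ) - 1‖ with hδ
    have hδ0 : 0 ≤ δ := norm_nonneg _
    have hcard : (1 : ℝ) ≤ Fintype.card n := by exact_mod_cast Fintype.card_pos
    have h2δ : 2 * δ ≤ 1 := by nlinarith
    obtain ⟨u, D, d, hD, hx⟩ := exists_conj_eq_diagonal U
    -- the eigenvalues `d k` have norm one and product one
    have hd1 : ∀ k, ‖d k‖ = 1 := norm_eq_one_of_coe_eq_diagonal hD
    have hdprod : ∏ k, d k = 1 := prod_eq_one_of_coe_eq_diagonal hD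
    -- `‖D - 1‖ = δ`
    have hDU : (D : Matrix n n ℂ) = ((u⁻¹ : Matrix.specialUnitaryGroup n ℂ) : Matrix n n ℂ) * (U : Matrix n n ℂ) *
        (((u⁻¹)⁻¹ : Matrix.specialUnitaryGroup n ℂ) : Matrix n n ℂ) := by
      rw [← Submonoid.coe_mul, ← Submonoid.coe_mul, hx]
      congr 1
      group
    have hD1 : ‖(D : Matrix n n ℂ) - 1‖ = δ := by
      have : (D : Matrix n n ℂ) - 1 = ((u⁻¹ : Matrix.specialUnitaryGroup n ℂ) : Matrix n n ℂ) * ((U : Matrix n n ℂ) - 1) *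
          (((u⁻¹)⁻¹ : Matrix.specialUnitaryGroup n ℂ) : Matrix n n ℂ) := by
        rw [Matrix.mul_sub, Matrix.sub_mul, ← hDU, Matrix.mul_one, ← Submonoid.coe_mul,
          mul_inv_cancel, Submonoid.coe_one]
      rw [this, norm_conj]
    -- the arguments
    set θ : n → ℝ := fun k => (d k).arg with hθ
    have hdθ : ∀ k, cexp (θ k * I) = d k := fun k => exp_arg_mul_I_of_norm_eq_one (hd1 k)
    have hθle : ∀ k, |θ k| ≤ 2 * δ := by
      intro k
      have h1 : |θ k| ≤ Real.pi / 2 * ‖cexp (θ k * I) - 1‖ :=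
        abs_le_pi_div_two_mul_norm_exp_mul_I_sub_one (Complex.abs_arg_le_pi _)
      have hDkk : ((D : Matrix n n ℂ) - 1) k k = d k - 1 := by
        rw [Matrix.sub_apply, hD, diagonal_apply_eq, one_apply_eq]
      have h2 : ‖cexp (θ k * I) - 1‖ ≤ δ := by
        rw [hdθ, ← hD1, ← hDkk]
        exact norm_apply_le_norm ((D : Matrix n n ℂ) - 1) k k
      have hpi4 : Real.pi / 2 ≤ 2 := by linarith [Real.pi_le_four]
      calc |θ k| ≤ Real.pi / 2 * ‖cexp (θ k * I) - 1‖ := h1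
        _ ≤ 2 * δ := mul_le_mul hpi4 h2 (norm_nonneg _) zero_le_two
    have hθ1 : ∀ k, |θ k| ≤ 1 := fun k => (hθle k).trans h2δ
    -- the arguments sum to zero
    have hsum : ∑ k, θ k = 0 := by
      apply eq_zero_of_exp_mul_I_eq_one
      · rw [ofReal_sum, Finset.sum_mul, Complex.exp_sum]
        simp_rw [hdθ]
        exact hdprod
      · calc |∑ k, θ k| ≤ ∑ k, |θ k| := Finset.abs_sum_le_sum_abs _ _
          _ ≤ ∑ _k : n, 2 * δ := Finset.sum_le_sum fun k _ => hθle k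
          _ = Fintype.card n * (2 * δ) := by simp
          _ ≤ 1 := by nlinarith
          _ < 2 * Real.pi := by linarith [Real.pi_gt_three]
    -- the logarithm
    set uM : Matrix n n ℂ := (u : Matrix n n ℂ) with huM
    have hu : uM ∈ Matrix.unitaryGroup n ℂ := u.2.1
    have hustar : ((u⁻¹ : Matrix.specialUnitaryGroup n ℂ) : Matrix n n ℂ) = star uM := rfl
    have hUconj : (U : Matrix n n ℂ) = uM * diagonal d * star uM := by
      rw [← hustar, ← hD, huM, ← Submonoid.coe_mul, ← Submonoid.coe_mul, ← hx]
    refine ⟨uM * diagonal (fun k => ((θ k : ℝ) : ℂ)) * star uM, ?_, ?_, ?_, ?_⟩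
    · -- Hermitian
      have hdiag : (diagonal fun k => ((θ k : ℝ) : ℂ)).IsHermitian :=
        Matrix.isHermitian_diagonal_iff.2 fun k => by
          rw [isSelfAdjoint_iff, Complex.star_def, Complex.conj_ofReal]
      simpa only [star_eq_conjTranspose] using isHermitian_mul_mul_conjTranspose uM hdiag
    · -- traceless
      rw [trace_mul_cycle, Unitary.star_mul_self_of_mem hu, Matrix.one_mul, trace_diagonal,
        ← ofReal_sum, hsum, ofReal_zero]
    · -- norm
      rw [norm_unitary_conj hu]
      refine norm_diagonal_le (by positivity) fun k => ?_
      rw [Complex.norm_real, Real.norm_eq_abs]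
      exact hθle k
    · -- second-order remainder
      have hfun : (d - (fun _ => (1 : ℂ)) - I • fun k => ((θ k : ℝ) : ℂ)) =
          fun k => d k - 1 - θ k * I := by
        funext k
        simp only [Pi.sub_apply, Pi.smul_apply, smul_eq_mul]
        ring
      have hrw : (U : Matrix n n ℂ) - 1 - I • (uM * diagonal (fun k => ((θ k : ℝ) : ℂ)) * star uM)
          = uM * diagonal (fun k => d k - 1 - θ k * I) * star uM := by
        rw [hUconj, one_eq_conj_diagonal_one hu, smul_conj_diagonal, conj_diagonal_sub,
          conj_diagonal_sub, hfun]
      rw [hrw, norm_unitary_conj hu]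
      refine norm_diagonal_le (by positivity) fun k => ?_
      rw [← hdθ]
      calc ‖cexp (θ k * I) - 1 - θ k * I‖ ≤ θ k ^ 2 := norm_exp_mul_I_sub_one_sub_le (hθ1 k)
        _ = |θ k| ^ 2 := (sq_abs _).symm
        _ ≤ (2 * δ) ^ 2 := pow_le_pow_left₀ (abs_nonneg _) (hθle k) 2
        _ = 4 * δ ^ 2 := by ring

/-! ### Special unitaries with prescribed first-order term -/

/-- For `Q` unitary and real `γ` summing to `0` with `|γ_k| ≤ r ≤ 1`, the matrix
`V = Q · diag(e^{iγ_k}) · Q⋆` lies in `SU(n)` and satisfies `‖V - 1‖ ≤ r` and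
`‖V - 1 - i Q·diag(γ)·Q⋆‖ ≤ r²`. [folklore] -/
theorem exists_specialUnitary_near_conj_diagonal {Q : Matrix n n ℂ}
    (hQ : Q ∈ Matrix.unitaryGroup n ℂ) (γ : n → ℝ) (hsum : ∑ k, ((γ k : ℝ) : ℂ) = 0) {r : ℝ}
    (hr0 : 0 ≤ r) (hr : ∀ k, |γ k| ≤ r) (hr1 : r ≤ 1) :
    ∃ V : Matrix.specialUnitaryGroup n ℂ, ‖(V : Matrix n n ℂ) - 1‖ ≤ r ∧
      ‖(V : Matrix n n ℂ) - 1 - I • (Q * diagonal (fun k => ((γ k : ℝ) : ℂ)) * star Q)‖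
        ≤ r ^ 2 := by
  have hγ1 : ∀ k, |γ k| ≤ 1 := fun k => (hr k).trans hr1
  have hw1 : ∀ k, ‖cexp (γ k * I)‖ = 1 := fun k => Complex.norm_exp_ofReal_mul_I _
  have hwU : diagonal (fun k => cexp (γ k * I)) ∈ Matrix.unitaryGroup n ℂ :=
    (diagonal_mem_unitaryGroup_iff _).2 hw1
  have hwdet : (diagonal fun k => cexp (γ k * I)).det = 1 := by
    rw [det_diagonal, ← Complex.exp_sum, ← Finset.sum_mul, hsum, zero_mul, Complex.exp_zero]
  have hVU : Q * diagonal (fun k => cexp (γ k * I)) * star Q ∈ Matrix.unitaryGroup n ℂ :=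
    Submonoid.mul_mem _ (Submonoid.mul_mem _ hQ hwU) (Unitary.star_mem hQ)
  have hVdet : (Q * diagonal (fun k => cexp (γ k * I)) * star Q).det = 1 := by
    rw [det_mul, det_mul, hwdet, mul_one, ← det_mul, Unitary.mul_star_self_of_mem hQ, det_one]
  refine ⟨⟨Q * diagonal (fun k => cexp (γ k * I)) * star Q,
    Matrix.mem_specialUnitaryGroup_iff.2 ⟨hVU, hVdet⟩⟩, ?_, ?_⟩
  · change ‖Q * diagonal (fun k => cexp (γ k * I)) * star Q - 1‖ ≤ r
    rw [one_eq_conj_diagonal_one hQ, conj_diagonal_sub, norm_unitary_conj hQ]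
    refine norm_diagonal_le hr0 fun k => ?_
    rw [Pi.sub_apply]
    exact (norm_exp_mul_I_sub_one_le (γ k)).trans (hr k)
  · change ‖Q * diagonal (fun k => cexp (γ k * I)) * star Q - 1 -
        I • (Q * diagonal (fun k => ((γ k : ℝ) : ℂ)) * star Q)‖ ≤ r ^ 2
    rw [one_eq_conj_diagonal_one hQ, smul_conj_diagonal, conj_diagonal_sub, conj_diagonal_sub,
      norm_unitary_conj hQ]
    refine norm_diagonal_le (by positivity) fun k => ?_
    simp only [Pi.sub_apply, Pi.smul_apply, smul_eq_mul]
    calc ‖cexp (γ k * I) - 1 - I * (γ k : ℂ)‖ = ‖cexp (γ k * I) - 1 - γ k * I‖ := by rw [mul_comm I]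
      _ ≤ γ k ^ 2 := norm_exp_mul_I_sub_one_sub_le (hγ1 k)
      _ = |γ k| ^ 2 := (sq_abs _).symm
      _ ≤ r ^ 2 := pow_le_pow_left₀ (abs_nonneg _) (hr k) 2

/-- **Exponentials of traceless Hermitian matrices, by hand.**  For `G` Hermitian and traceless
with `‖G‖ ≤ 1` there is `V ∈ SU(n)` with `‖V - 1‖ ≤ ‖G‖` and `‖V - 1 - iG‖ ≤ ‖G‖²`; namely
`V = Q · diag(e^{iγ_k}) · Q⋆` for the spectral decomposition `G = Q · diag(γ) · Q⋆`, whose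
determinant is `e^{i tr G} = 1`.  (Dawson–Nielsen 2006 §2 and §5.2: `d(I, exp(iH)) ≤ ‖H‖`,
`V = exp(iF) ∈ SU(d)`.) [cite: DawsonNielsen2006, §5.2] -/
theorem exists_specialUnitary_near {G : Matrix n n ℂ} (hG : G.IsHermitian) (htr : G.trace = 0)
    (h1 : ‖G‖ ≤ 1) :
    ∃ V : Matrix.specialUnitaryGroup n ℂ, ‖(V : Matrix n n ℂ) - 1‖ ≤ ‖G‖ ∧ ‖(V : Matrix n n ℂ) - 1 - I • G‖ ≤ ‖G‖ ^ 2 := by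
  have hQ : (hG.eigenvectorUnitary : Matrix n n ℂ) ∈ Matrix.unitaryGroup n ℂ :=
    hG.eigenvectorUnitary.2
  have hGconj : G = (hG.eigenvectorUnitary : Matrix n n ℂ) *
      diagonal (fun k => ((hG.eigenvalues k : ℝ) : ℂ)) *
        star (hG.eigenvectorUnitary : Matrix n n ℂ) := by
    have h := hG.spectral_theorem
    rw [Unitary.conjStarAlgAut_apply] at h
    exact h
  have hγle : ∀ k, |hG.eigenvalues k| ≤ ‖G‖ := by
    intro k
    have h : ‖((hG.eigenvalues k : ℝ) : ℂ)‖ ≤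
        ‖diagonal (fun k => ((hG.eigenvalues k : ℝ) : ℂ))‖ :=
      norm_apply_le_norm_diagonal (fun k => ((hG.eigenvalues k : ℝ) : ℂ)) k
    rw [Complex.norm_real, Real.norm_eq_abs] at h
    calc |hG.eigenvalues k| ≤ _ := h
      _ = ‖(hG.eigenvectorUnitary : Matrix n n ℂ) *
            diagonal (fun k => ((hG.eigenvalues k : ℝ) : ℂ)) *
              star (hG.eigenvectorUnitary : Matrix n n ℂ)‖ := (norm_unitary_conj hQ _).symm
      _ = ‖G‖ := by rw [← hGconj]
  have hsum : ∑ k, ((hG.eigenvalues k : ℝ) : ℂ) = 0 := by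
    have h := hG.trace_eq_sum_eigenvalues
    rw [htr, RCLike.ofReal_eq_complex_ofReal] at h
    exact h.symm
  obtain ⟨V, hV1, hV2⟩ := exists_specialUnitary_near_conj_diagonal hQ hG.eigenvalues hsum
    (norm_nonneg G) hγle h1
  refine ⟨V, hV1, ?_⟩
  rwa [← hGconj] at hV2

end Literature.Computability.QuantumComplexity.SolovayKitaev
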